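import Mathlib
import Literature.NumberTheory.LFunctions.WeilOddGroundState
import Summits.RiemannHypothesis.RiemannHypothesis.Theorems.GroundBartaEvenWinsBeyondArchUpper78Sharp
import Summits.RiemannHypothesis.RiemannHypothesis.Theorems.WeilGroundStateGroundStateSimpleEvenCellTransfer
import HarnessLib

/-!
# The parity ladder beyond `log 2`: the LAST three-prime cell `[39/50, 4023/5000]` from an odd-sector lower bound at `4023/5000`

Route WeilParity item `NoParityCrossing` (stmt-RiemannHypothesis-18085; stub `stub_tailSimpleEven`) ≡ GroundBarta rung 4
(`EvenWinsBeyondArch`, stmt-RiemannHypothesis-18807).  Pure logic, RH-free, no named facts.  Prover A (gen 5).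

With the SHARP U-side `trialUpper78sharp : ε(39/50) ≤ 1/(6·10¹⁵)` (even degree-54 Ritz vector, sharp Markov bracket), the cell
transfer `GroundStateSimpleEven.weilWindowSimpleEven_on_cell_of_le` reduces the whole cell `[39/50, 4023/5000]`
(`4023/5000 = 0.8046 < (log 5)/2 = 0.80472`) to ONE odd-sector lower bound `1/(6·10¹⁵) < L ≤ ε_od(4023/5000)` (the deflated
Temple L-side at `b = 4023/5000` with the `N = 271` certificate format; `ε_od(4023/5000) ≈ 1.02·10⁻¹⁴`).  Combined with
`WeilWindowSimpleEven` on `(0, 39/50]` this gives `WeilWindowSimpleEven` on `(0, 4023/5000]`.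
-/

set_option linter.dupNamespace false

noncomputable section

open Set MeasureTheory

namespace Summit.RiemannHypothesis.RiemannHypothesis.Theorems.EvenWinsBeyondArch

open Literature.NumberTheory.LFunctions

/-- **The cell `[39/50, 4023/5000]`**: `1/(6·10¹⁵) < L ≤ ε_od(4023/5000) ⟹ WeilWindowSimpleEven a` for `a ∈ [39/50, 4023/5000]`. [folklore] -/
theorem weilWindowSimpleEven_on_cell_M80_of_oddLower {L : ℝ} (hUL : (1 / 6000000000000000 : ℝ) < L)
    (hL : L ≤ weilOddGroundEnergy (4023 / 5000 : ℝ)) {a : ℝ} (hlo : (39 / 50 : ℝ) ≤ a) (hhi : a ≤ 4023 / 5000) :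
    WeilWindowSimpleEven a :=
  GroundStateSimpleEven.weilWindowSimpleEven_on_cell_of_le (b := (39 / 50 : ℝ)) (c := (4023 / 5000 : ℝ)) (by norm_num) hUL
    trialUpper78sharp (fun _ hg hs hn ho ↦ hL.trans (weilOddGroundEnergy_le hg hs ho hn)) hlo hhi

/-- **`WeilWindowSimpleEven` on `(0, 4023/5000]`** from `WeilWindowSimpleEven` on `(0, 39/50]` and the odd-sector lower bound
at `4023/5000`. [folklore] -/
theorem weilWindowSimpleEven_upTo_M80_of_oddLower (h78 : ∀ a : ℝ, 0 < a → a ≤ 39 / 50 → WeilWindowSimpleEven a)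
    {L : ℝ} (hUL : (1 / 6000000000000000 : ℝ) < L) (hL : L ≤ weilOddGroundEnergy (4023 / 5000 : ℝ)) :
    ∀ a : ℝ, 0 < a → a ≤ 4023 / 5000 → WeilWindowSimpleEven a := by
  intro a ha hle
  rcases le_or_gt a (39 / 50) with h | h
  · exact h78 a ha h
  · exact weilWindowSimpleEven_on_cell_M80_of_oddLower hUL hL h.le hle

end Summit.RiemannHypothesis.RiemannHypothesis.Theorems.EvenWinsBeyondArch

end
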